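import Mathlib.Tactic

/-!
# Census checks (crux-strategist gen 1, seat s1) — crux `SelmerRankLB` (stmt-BirchSwinnertonDyer-0131)

Companion to `STRATEGY-CENSUS.md` §Negation (N6): the PHANTOM PROFILE of a minimal counterexample to the
crux is consistent with every implication among the six rank-like invariants that is a theorem in print
under the crux's hypotheses (`p ≥ 5` good ordinary, `ρ̄` onto, `w(E) = +1`, `L(E,1) = 0`).

Invariants of one `(E, p, K)`: `r = r_an(E)`, `m = rank E(ℚ)`, `c = corank_p Sel_{p^∞}(E/ℚ)`,
`v = ord_{T=0} L_p(E,T)`, `d = ord(δ̃)` (Kurihara), `h = ord κ^{Heeg}` (Heegner, with `c' = corank_p(E^{d_K}) = 1`).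
Known constraints (all theorems): parity `c ≡ r`, `v ≡ r` (Dokchitser–Dokchitser 2010; `p`-adic functional
equation); `r ≥ 1 → c ≥ 1` (Burungale–Castella–Skinner 2025 Thm 1.1.2); `c = 0 → r = 0`, `c = 1 → r = 1`
(Skinner–Urban 2014; corank-1 `p`-converse 2024–26); `m ≤ c` (Kummer); `c ≤ v`, `m ≤ v` (Kato 2004 Thm 18.4);
`d = c` (Kim 2022 Thm 1.9); `h + 1 = max(c, c')` (Kolyvagin 1991 Thm 4 + Zhang 2014 Thm 1.1); the known range
`r ≤ 3 → r ≤ c`. The phantom profile `(r, m, c, v, d, h, c') = (4, 2, 2, 2, 2, 1, 1)` satisfies all of them and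
violates the crux (`r ≤ c`), its weakest `p`-adic consequence A1 (`r ≤ v`) and BSD-rank (`r = m`) at once:
no non-archimedean theorem on record separates the phantom world from the honest one. Pure arithmetic
(`decide`); it certifies the bookkeeping of §Negation, nothing about elliptic curves.
-/

namespace SelmerRankLBCensusS1

/-- The printed constraints among `(r, m, c, v, d, h, c')`, as a decidable predicate. [folklore] -/
def KnownConstraints (r m c v d h c' : ℕ) : Prop :=
  c % 2 = r % 2 ∧ v % 2 = r % 2 ∧ (1 ≤ r → 1 ≤ c) ∧ (c = 0 → r = 0) ∧ (c = 1 → r = 1) ∧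
    m ≤ c ∧ c ≤ v ∧ m ≤ v ∧ d = c ∧ h + 1 = max c c' ∧ (r ≤ 3 → r ≤ c)

instance (r m c v d h c' : ℕ) : Decidable (KnownConstraints r m c v d h c') := by
  unfold KnownConstraints; infer_instance

/-- **(N6)** The phantom profile `(4, 2, 2, 2, 2, 1, 1)` meets every printed constraint and violates the crux,
A1 and BSD-rank simultaneously. [folklore] -/
theorem phantom_profile_consistent :
    KnownConstraints 4 2 2 2 2 1 1 ∧ ¬ (4 ≤ 2) ∧ ¬ ((4 : ℕ) = 2) := by decide

/-- **(N6′)** … and it is the MINIMAL such profile: with `r ≤ 3` the printed constraints already force the crux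
(`r ≤ c`) — the known range. [folklore] -/
theorem no_phantom_below_four :
    ∀ r m c v d h c' : Fin 8, KnownConstraints r m c v d h c' → (r : ℕ) ≤ 3 → (r : ℕ) ≤ c := by
  intro r m c v d h c' hK hr
  exact hK.2.2.2.2.2.2.2.2.2.2 hr

end SelmerRankLBCensusS1
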